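import Literature.AlgebraicGeometry.Frobenioids.ArchimedeanAngloidIrreduciblesR
import Literature.AlgebraicGeometry.Frobenioids.ArchimedeanQuotientLiftingRigidAsTyped
import HarnessLib

/-!
# Frobenioids II, Proposition 3.5 (iii) for the rigidified angloid `R` — PROVED AS TYPED
# (`ArchFrd.Prop35iii_R`, every base `π : D → D₀`; proof-only)

Mochizuki, *The geometry of Frobenioids II: poly-Frobenioids*, Kyushu J. Math. **62** (2008) 401–460,
§3, Proposition 3.5 (iii) p. 34, proof p. 35 ll. 28–40 [cite: MochizukiFrdII2008, Prop 3.5 (iii) p.34]: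
"(iii) The categories `N`, `R` are of RC-iso-subanchor type" (w.r.t. `N, R → C → D → D₀`, [FrdII]
Def. 3.1 (v)), for `D` of RC-iso-subanchor type.

This PROOF-ONLY file discharges the typed instance `ArchFrd.Prop35iii_R π` of
`ArchimedeanTheoremsInstances.lean` (abc-iut-L1-t9) AS TYPED, for EVERY functor `π : D → D₀` — in
contrast with the twin instance `Prop35iii_N`, which is false over a Galois-collapsing base
(`ArchFrd.not_prop35iii_N_collapse`, `ArchimedeanProp35iiiCounterexample.lean`).  For `A ∈ Ob(R)` take a
presentation `(B_D, G_D, B_D → A_D)` of `A_D` as a mono-minimal categorical quotient of an RC-subanchor of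
`D`; its RIGID LIFT `B → A` ([FrdII] Prop. 3.5 (i) for `H = R`: abc-iut-w4-d100's `QuotientLiftR`, and its
saturation-free form `QuotientLiftR.isMonoMinimalQuotient_liftMorR'` of
`ArchimedeanQuotientLiftingRigidAsTyped.lean` — the rigidification descends the scalar, no Galois
saturation) is a mono-minimal categorical quotient of `B` by the lifted group in `R`, and `B` is an
RC-subanchor of `R`: an arrow `B_D → C_D` to an RC-anchor `C_D` of `D` lifts to the arrow `(id, B_D → C_D)`
of `R` into `(B₀, C_D)`, an RC-anchor of `R` by the ANCHOR TRANSFER `R.isRCAnchor_of_isRCAnchor_base`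
(`ArchimedeanAngloidIrreduciblesR.lean`: irreducibles of `R[ℂ]` are pull-back-type or slit-type, finitely
many classes by the anchor `C_D` and [FrdII] Lem. 3.2 (vii)).  Contents: `R.isRCSubanchor_liftObjR`,
**`prop35iii_R_holds : Prop35iii_R π`** (+ alias `Prop35iii_R_holds`).

Sub-DAG row P35-L06 `AngloidRCIsoSubanchor` (plan/L1/SUBDAG-FrdII-Thm36-Prop35.md), R-half; seat
abc-iut-w4-d027 (gen 2).  No definitions; no statement re-typed; nothing here bears on [IUTchIII] Cor. 3.12.
-/

namespace Literature.AlgebraicGeometry.Frobenioids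

open CategoryTheory
open scoped Pointwise

noncomputable section

namespace ArchFrd

universe v u

variable {D : Type u} [Category.{v} D] (π : D ⥤ D0)

/-! ### The lift is an RC-subanchor; Proposition 3.5 (iii) for `R` -/

/-- **The rigid lift `B` of an RC-subanchor `B_D` of `D` is an RC-subanchor of `R`**: an arrow
`B_D → C_D` to an RC-anchor `C_D` of `D` lifts to the arrow `(id, B_D → C_D)` of `R` into the object
`(B₀, C_D)`, which is an RC-anchor of `R` by the anchor transfer `R.isRCAnchor_of_isRCAnchor_base`.
[cite: MochizukiFrdII2008, Prop 3.5 (iii) p.34] -/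
theorem R.isRCSubanchor_liftObjR (Q : R π) {BD : D} (fD : BD ⟶ (QuotientLiftR.QC π Q).snd)
    (hB : RC.IsRCSubanchor (baseRC π) BD) :
    RC.IsRCSubanchor (R.toC π ⋙ PreFrobenioid.baseFunctor (C.toElem π) ⋙ baseRC π)
      (QuotientLiftR.liftObjR π Q fD) := by
  obtain ⟨CD, hCD, ⟨h⟩⟩ := hB
  obtain ⟨hCc', -⟩ := id hCD
  have hCc : (π.obj CD).IsComplex := (D0.isComplex_toArchBase_iff _).mp hCc'
  haveI hι : IsIso (π.map h) := D0.isIso_of_isComplex_target _ hCc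
  let B' : R π := ⟨(QuotientLiftR.liftObjR π Q fD).fst, CD, @asIso _ _ _ _ (π.map h) hι⟩
  refine ⟨B', R.isRCAnchor_of_isRCAnchor_base π B' hCD, ⟨⟨𝟙 _, h, ?_⟩⟩⟩
  rw [CategoryTheory.Functor.map_id, Category.id_comp]
  exact (Category.id_comp _).symm

/-- **[FrdII] Proposition 3.5 (iii) for the rigidified angloid `R`, AS TYPED, every base `π : D → D₀`**:
if `D` is of RC-iso-subanchor type (w.r.t. `D → D₀`), then so is `R = R₀ ×_{D₀} D` (w.r.t.
`R → C → D → D₀`). For `A ∈ Ob(R)` take a presentation `(B_D, G_D, B_D → A_D)` of `A_D` in `D`; its rigid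
lift `B → A` (abc-iut-w4-d100's `QuotientLiftR`) is a mono-minimal categorical quotient by the lifted group
WITHOUT Galois saturation (`isMonoMinimalQuotient_liftMorR'`), and `B` is an RC-subanchor
(`R.isRCSubanchor_liftObjR`). [cite: MochizukiFrdII2008, Prop 3.5 (iii) p.34] -/
theorem prop35iii_R_holds : Literature.AlgebraicGeometry.Frobenioids.ArchFrd.Prop35iii_R π := by
  intro hD
  refine ⟨fun Q => ?_⟩
  obtain ⟨BD, GD, fD, hB, hq⟩ := hD.isRCIsoSubanchor Q.snd
  change BD ⟶ (QuotientLiftR.QC π Q).snd at fD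
  exact ⟨QuotientLiftR.liftObjR π Q fD, (QuotientLiftR.liftAutHomR π Q fD GD hq.1.1).range,
    QuotientLiftR.liftMorR π Q fD, R.isRCSubanchor_liftObjR π Q fD hB,
    QuotientLiftR.isMonoMinimalQuotient_liftMorR' π Q fD hq⟩

/-- **[FrdII] Prop. 3.5 (iii) for `R` — discharge of the named instance `Prop35iii_R`** (alias).
[cite: MochizukiFrdII2008, Prop 3.5 (iii) p.34] -/
theorem Prop35iii_R_holds : Prop35iii_R π := prop35iii_R_holds π

end ArchFrd

end

end Literature.AlgebraicGeometry.Frobenioids
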